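import Summits.CriticalPhenomena.PercolationContinuityZ3.Theorems.PercNearOneGluingNoHeavyLowerTailKnQuestion8CoefficientwiseRootRegrouping
import Summits.CriticalPhenomena.PercolationContinuityZ3.Theorems.PercNearOneGluingNoHeavyLowerTailKnQuestion8CoefficientwiseDoubling
import Summits.CriticalPhenomena.PercolationContinuityZ3.Theorems.PercNearOneGluingNoHeavyLowerTailKnQuestion8CoefficientwiseComponentFlip
import HarnessLib

/-!
# THEOREM R30a: the first rung (CW-PA) for all finite multigraphs follows from conjecture RZ (prim-lf-2 gen 30)

Support file (`--supports stmt-CriticalPhenomena-4575`, closed), prover `prim-lf-2` (gen 30).  No definitions, no named facts, no sorries; standard axioms.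
Memo `prim-lf-2/CW-ROOT-gen30.md` §2 (THEOREM R30a); companions `…CoefficientwiseRootRegrouping.lean` (p261590: the root regrouping identity at one edge),
`…CoefficientwiseOffClusterPred.lean` (p263680: RZ for a pendant conditioning vertex), `…CoefficientwiseDoubling.lean` (contraction of an edge).

Objects (end-point map `ends : ι → Sym2 V`, edge set `E`, terminals `x ≠ z`, colourings `t ⊆ E` red / `E ∖ t` blue, `C_v(t) = openCluster (ends '' t) v`):
* the AVOIDING FIRST RUNG `MA(E; A)[f,g] = Σ_{t ⊆ E : z ∉ C_x(t), z ∉ C_x(E∖t), A ∩ (C_z(t) ∪ C_z(E∖t)) = ∅} (f(C_x t) − f(C_x(E∖t)))(g(C_x t) − g(C_x(E∖t)))`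
  (`A = ∅`: the first-rung form `T'(E)`, whose nonnegativity at monotone pairs is CW-PA, i.e. membership of `(E; x, z)` in the class `𝒞`);
* for a root edge `e ∈ E` with ends `{x, a}` and `E' = E ∖ e`, the RESTRICTED KERNEL
  `RZ(E, e; A)[f,g] = Σ_{s ⊆ E' : z ∈ C_x(s∪e) ∖ C_x(s), z ∉ C_x((E'∖s)∪e), A ∩ (C_z(s) ∪ C_z(E'∖s)) = ∅} (f(C_x s) − f(C_x((E'∖s)∪e)))(g(C_x s) − g(C_x((E'∖s)∪e)))`
  — the first-rung summands of the colourings with `e` BLUE and red-pivotal (`z ∈ C_x(s∪e) ∖ C_x(s)` says `a ∈ C_z(s)`, `mem_insert_root_iff`), i.e. the kernel of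
  `(E;x,z)` restricted to `{a ∈ C_z^{red}}` and to `A` unjoined to `z`.
THEOREM R30a (`Coefficientwise.firstRung_nonneg_of_rz`).  Fix terminals `x, z` (for `x = z` everything is `0`).  Suppose that for every end-point map, edge set, finite `A` and monotone `f, g`, whenever
`x` has a FREE root edge (ends `{x,a}`, `a ∉ {x, z} ∪ A`) some free root edge has `RZ(E,e;A)[f,g] ≥ 0`.  Then `MA(E;A)[f,g] ≥ 0` for all `E, A` and monotone
`f, g` — in particular (`A = ∅`) every `(E; x, z)` is in `𝒞`.  Proof = induction on `|E|` with the one-step inequality (`Coefficientwise.firstRung_avoid_step`)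
  `MA(E;A) ≥ MA(E/e;A)[f∘r⁻¹, g∘r⁻¹] + MA(E∖e; A ∪ {a}) + 2·RZ(E,e;A)`
(the root regrouping identity of p261590 with the `z`-avoidance weight, the cross term `X ≥ 0` dropped, the contraction written with the relabelling
`r : a ↦ x` of `…CoefficientwiseDoubling.lean`), plus the degenerate cases (an `x–z` edge: `MA = 0`; no proper root edge: `MA = 0`; only avoided root
edges: `RZ = 0`).  The only inequality used is `X ≥ 0`; RZ is census-clean (≈1.5·10⁵ instances, memo §3), proved for pendant `z` (p263680), open in general;
the deeper strata of the same expansion are false (memo §4), so R30a is the sharp form of the reduction.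
[cite: KozmaNitzan2024, Questions 8–9 (§5.5 p. 36) (context: first rung of the coefficientwise programme for Question 8)]
-/

namespace Summit.CriticalPhenomena.PercolationContinuityZ3.Theorems

open Finset Literature.Probability.Percolation

namespace Coefficientwise

variable {ι V : Type*} [DecidableEq ι] [DecidableEq V]

/-! ### Graph facts at a root edge `e = {x, a}` -/

omit [DecidableEq ι] [DecidableEq V] in
/-- If `x` meets only loops among the red edges, its red cluster is `{x}`. [cite: KozmaNitzan2024, §5.5 (context only; folklore)] -/
theorem mem_openCluster_iff_eq_of_noRoot (ends : ι → Sym2 V) {t : Finset ι} {x : V}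
    (h : ∀ i ∈ t, x ∈ ends i → ends i = s(x, x)) (y : V) :
    y ∈ openCluster (ends '' (↑t : Set ι)) x ↔ y = x := by
  constructor
  · intro hy
    obtain ⟨p⟩ := hy
    have htr : ∀ u ∈ ({w | w = x} : Set V), ∀ w, (openGraph (ends '' (↑t : Set ι))).Adj u w →
        (openGraph (ends '' (↑t : Set ι))).Adj u w ∧ w ∈ ({w | w = x} : Set V) := by
      intro u hu w hadj
      exfalso
      rw [Set.mem_setOf_eq] at hu
      subst hu
      rw [openGraph_image_adj] at hadj
      obtain ⟨⟨i, hit, hi⟩, hne⟩ := hadj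
      have hii := h i hit (by rw [hi]; exact Sym2.mem_mk_left u w)
      have hw : w ∈ s(u, u) := by rw [← hii, hi]; exact Sym2.mem_mk_right u w
      rcases Sym2.mem_iff.mp hw with hw | hw <;> exact hne hw.symm
    exact ((reachable_transfer {w | w = x} htr p) rfl).2
  · rintro rfl; exact mem_openCluster_self _ _

omit [DecidableEq V] in
/-- `z` misses the red cluster of `x` for `s ∪ {e}` (`e = {x,a}`) iff it misses it for `s` and `a` is not red-joined to `z` in `s`.
[cite: KozmaNitzan2024, §5.5 (context only; folklore)] -/
theorem not_mem_insert_root_iff (ends : ι → Sym2 V) {e : ι} {x a : V} (he : ends e = s(x, a)) (s : Finset ι) (z : V) :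
    z ∉ openCluster (ends '' (↑(insert e s) : Set ι)) x ↔
      (z ∉ openCluster (ends '' (↑s : Set ι)) x ∧ a ∉ openCluster (ends '' (↑s : Set ι)) z) := by
  have key := mem_insert_root_iff ends he s z
  have hmono : openCluster (ends '' (↑s : Set ι)) x ⊆ openCluster (ends '' (↑(insert e s) : Set ι)) x :=
    openCluster_image_mono ends (Finset.subset_insert e s) x
  constructor
  · intro hz
    refine ⟨fun h => hz (hmono h), fun ha => hz ?_⟩
    exact (key.mpr ⟨fun h => hz (hmono h), ha⟩).1
  · rintro ⟨hz, ha⟩ hzc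
    exact ha (key.mp ⟨hzc, hz⟩).2

omit [DecidableEq V] in
/-- If `z` misses the red cluster of `x` for `s ∪ {e}` (`e = {x,a}` a root edge), then the red cluster of `z` does not use `e`.
[cite: KozmaNitzan2024, §5.5 (context only; folklore)] -/
theorem openCluster_z_insert_root (ends : ι → Sym2 V) {e : ι} {x a z : V} (he : ends e = s(x, a)) {s : Finset ι}
    (hz : z ∉ openCluster (ends '' (↑(insert e s) : Set ι)) x) :
    openCluster (ends '' (↑(insert e s) : Set ι)) z = openCluster (ends '' (↑s : Set ι)) z := by
  refine Set.Subset.antisymm ?_ (openCluster_image_mono ends (Finset.subset_insert e s) z)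
  intro y hy
  change (openGraph (ends '' (↑(insert e s) : Set ι))).Reachable z y at hy
  rw [image_coe_insert, he, KNSep.reachable_insert_iff] at hy
  rcases hy with h | ⟨h, _⟩ | ⟨h, _⟩
  · exact h
  · exact absurd (openCluster_image_mono ends (Finset.subset_insert e s) x (SimpleGraph.Reachable.symm h)) hz
  · exfalso
    apply hz
    change (openGraph (ends '' (↑(insert e s) : Set ι))).Reachable x z
    rw [image_coe_insert, he, KNSep.reachable_insert_iff]
    exact Or.inr (Or.inl ⟨SimpleGraph.Reachable.refl x, SimpleGraph.Reachable.symm h⟩)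

omit [DecidableEq ι] in
/-- After contracting the root edge `{x,a}` (relabelling `r : a ↦ x`), no edge meets `a`. [cite: KozmaNitzan2024, §5.5 (context only; folklore)] -/
theorem not_mem_map_contract (ends : ι → Sym2 V) {x a : V} (hxa : x ≠ a) (i : ι) :
    a ∉ Sym2.map (fun w => if w = a then x else w) (ends i) := by
  intro h
  rw [Sym2.mem_map] at h
  obtain ⟨w, _, hw⟩ := h
  by_cases hwa : w = a
  · rw [if_pos hwa] at hw; exact hxa hw
  · rw [if_neg hwa] at hw; exact hwa hw

section main

open Classical

/-- **One root step of THEOREM R30a** (memo CW-ROOT-gen30 §2, (E1)+(E2) with the cross term dropped).  For a root edge `e ∈ E` with ends `{x,a}`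
(`a ∉ {x,z}`), `E' = E ∖ e`, the relabelling `r : a ↦ x` (so that clusters with `e` conducting are pull-backs of clusters of the contraction
`(E', Sym2.map r ∘ ends)`), a finite set `A` of vertices to be avoided by both clusters of `z`, and monotone `f, g`:
  `MA(E', contracted; A)[f∘r⁻¹, g∘r⁻¹] + MA(E'; A ∪ {a})[f,g] + 2·RZ(E,e;A)[f,g] ≤ MA(E;A)[f,g]`.
[cite: KozmaNitzan2024, Questions 8–9 (§5.5 p. 36) (context)] -/
theorem firstRung_avoid_step (ends : ι → Sym2 V) (E : Finset ι) {e : ι} (he : e ∈ E) {x a z : V} (hea : ends e = s(x, a))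
    (hxa : x ≠ a) (hza : z ≠ a) (A : Finset V) (f g : Set V → ℝ) (hf : Monotone f) (hg : Monotone g) :
    (∑ s ∈ (E.erase e).powerset,
        (if z ∉ openCluster ((fun i => Sym2.map (fun w => if w = a then x else w) (ends i)) '' (↑s : Set ι)) x ∧
              z ∉ openCluster ((fun i => Sym2.map (fun w => if w = a then x else w) (ends i)) '' (↑(E.erase e \ s) : Set ι)) x ∧
              ∀ b ∈ A, b ∉ openCluster ((fun i => Sym2.map (fun w => if w = a then x else w) (ends i)) '' (↑s : Set ι)) z ∧
                b ∉ openCluster ((fun i => Sym2.map (fun w => if w = a then x else w) (ends i)) '' (↑(E.erase e \ s) : Set ι)) z then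
          (f {y | (if y = a then x else y) ∈ openCluster ((fun i => Sym2.map (fun w => if w = a then x else w) (ends i)) '' (↑s : Set ι)) x} -
              f {y | (if y = a then x else y) ∈
                openCluster ((fun i => Sym2.map (fun w => if w = a then x else w) (ends i)) '' (↑(E.erase e \ s) : Set ι)) x}) *
            (g {y | (if y = a then x else y) ∈ openCluster ((fun i => Sym2.map (fun w => if w = a then x else w) (ends i)) '' (↑s : Set ι)) x} -
              g {y | (if y = a then x else y) ∈
                openCluster ((fun i => Sym2.map (fun w => if w = a then x else w) (ends i)) '' (↑(E.erase e \ s) : Set ι)) x})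
        else 0)) +
      (∑ s ∈ (E.erase e).powerset,
        (if z ∉ openCluster (ends '' (↑s : Set ι)) x ∧ z ∉ openCluster (ends '' (↑(E.erase e \ s) : Set ι)) x ∧
              ∀ b ∈ insert a A, b ∉ openCluster (ends '' (↑s : Set ι)) z ∧ b ∉ openCluster (ends '' (↑(E.erase e \ s) : Set ι)) z then
          (f (openCluster (ends '' (↑s : Set ι)) x) - f (openCluster (ends '' (↑(E.erase e \ s) : Set ι)) x)) *
            (g (openCluster (ends '' (↑s : Set ι)) x) - g (openCluster (ends '' (↑(E.erase e \ s) : Set ι)) x))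
        else 0)) +
      2 * (∑ s ∈ (E.erase e).powerset,
        (if z ∈ openCluster (ends '' (↑(insert e s) : Set ι)) x ∧ z ∉ openCluster (ends '' (↑s : Set ι)) x ∧
              z ∉ openCluster (ends '' (↑(insert e (E.erase e \ s)) : Set ι)) x ∧
              ∀ b ∈ A, b ∉ openCluster (ends '' (↑s : Set ι)) z ∧ b ∉ openCluster (ends '' (↑(E.erase e \ s) : Set ι)) z then
          (f (openCluster (ends '' (↑s : Set ι)) x) - f (openCluster (ends '' (↑(insert e (E.erase e \ s)) : Set ι)) x)) *
            (g (openCluster (ends '' (↑s : Set ι)) x) - g (openCluster (ends '' (↑(insert e (E.erase e \ s)) : Set ι)) x))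
        else 0)) ≤
      ∑ t ∈ E.powerset,
        (if z ∉ openCluster (ends '' (↑t : Set ι)) x ∧ z ∉ openCluster (ends '' (↑(E \ t) : Set ι)) x ∧
              ∀ b ∈ A, b ∉ openCluster (ends '' (↑t : Set ι)) z ∧ b ∉ openCluster (ends '' (↑(E \ t) : Set ι)) z then
          (f (openCluster (ends '' (↑t : Set ι)) x) - f (openCluster (ends '' (↑(E \ t) : Set ι)) x)) *
            (g (openCluster (ends '' (↑t : Set ι)) x) - g (openCluster (ends '' (↑(E \ t) : Set ι)) x))
        else 0) := by
  -- notation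
  set r : V → V := fun w => if w = a then x else w with hr
  set ends' : ι → Sym2 V := fun i => Sym2.map r (ends i) with hends'
  set K : Finset ι → Set V := fun s => openCluster (ends '' (↑s : Set ι)) x with hK
  set Cz : Finset ι → Set V := fun s => openCluster (ends '' (↑s : Set ι)) z with hCz
  set K' : Finset ι → Set V := fun s => openCluster (ends' '' (↑s : Set ι)) x with hK'
  set Cz' : Finset ι → Set V := fun s => openCluster (ends' '' (↑s : Set ι)) z with hCz'
  set E' : Finset ι := E.erase e with hE'
  set av : Finset ι → Prop := fun s => ∀ b ∈ A, b ∉ Cz s ∧ b ∉ Cz (E' \ s) with hav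
  set T : Finset ι → ℝ := fun t => if z ∉ K t ∧ z ∉ K (E \ t) ∧ ∀ b ∈ A, b ∉ Cz t ∧ b ∉ Cz (E \ t) then
      (f (K t) - f (K (E \ t))) * (g (K t) - g (K (E \ t))) else 0 with hT
  set Ac : Finset ι → ℝ := fun s => if z ∉ K' s ∧ z ∉ K' (E' \ s) ∧ ∀ b ∈ A, b ∉ Cz' s ∧ b ∉ Cz' (E' \ s) then
      (f {y | r y ∈ K' s} - f {y | r y ∈ K' (E' \ s)}) * (g {y | r y ∈ K' s} - g {y | r y ∈ K' (E' \ s)}) else 0 with hAc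
  set Ad : Finset ι → ℝ := fun s => if z ∉ K s ∧ z ∉ K (E' \ s) ∧ ∀ b ∈ insert a A, b ∉ Cz s ∧ b ∉ Cz (E' \ s) then
      (f (K s) - f (K (E' \ s))) * (g (K s) - g (K (E' \ s))) else 0 with hAd
  set Rz : Finset ι → ℝ := fun s => if z ∈ K (insert e s) ∧ z ∉ K s ∧ z ∉ K (insert e (E' \ s)) ∧ av s then
      (f (K s) - f (K (insert e (E' \ s)))) * (g (K s) - g (K (insert e (E' \ s)))) else 0 with hRz
  set Rb : Finset ι → ℝ := fun s => if z ∈ K (insert e (E' \ s)) ∧ z ∉ K (E' \ s) ∧ z ∉ K (insert e s) ∧ av s then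
      (f (K (insert e s)) - f (K (E' \ s))) * (g (K (insert e s)) - g (K (E' \ s))) else 0 with hRb
  change (∑ s ∈ E'.powerset, Ac s) + (∑ s ∈ E'.powerset, Ad s) + 2 * (∑ s ∈ E'.powerset, Rz s) ≤ ∑ t ∈ E.powerset, T t
  -- basic facts
  have heE' : e ∉ E' := Finset.notMem_erase e E
  have hEe : E = insert e E' := (Finset.insert_erase he).symm
  have hpow : E.powerset = (insert e E').powerset := by rw [← hEe]
  have hKmono : ∀ s : Finset ι, K s ⊆ K (insert e s) := fun s => openCluster_image_mono ends (Finset.subset_insert e s) x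
  have hCzmono : ∀ s : Finset ι, Cz s ⊆ Cz (insert e s) := fun s => openCluster_image_mono ends (Finset.subset_insert e s) z
  -- contraction: clusters with `e` red are pull-backs of contracted clusters (source `x` and source `z`)
  have contract_x : ∀ t : Finset ι, K (insert e t) = {y | r y ∈ K' t} := by
    intro t; ext y; exact mem_openCluster_insert_contract ends hea hxa hxa y
  have contract_z : ∀ t : Finset ι, Cz (insert e t) = {y | r y ∈ Cz' t} := by
    intro t; ext y; exact mem_openCluster_insert_contract ends hea hxa hza y
  have hrz : r z = z := by simp [hr, hza]
  have hrb : ∀ b, b ≠ a → r b = b := fun b hb => by simp [hr, hb]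
  have haCz' : ∀ t : Finset ι, a ∉ Cz' t := fun t =>
    not_mem_openCluster_of_forall_not_mem ends' (fun i _ => not_mem_map_contract ends hxa i) (Ne.symm hza)
  have hnotKc : ∀ s : Finset ι, z ∉ K (insert e s) ↔ (z ∉ K s ∧ a ∉ Cz s) := fun s => not_mem_insert_root_iff ends hea s z
  have hzK' : ∀ t : Finset ι, z ∉ K' t ↔ z ∉ K (insert e t) := by
    intro t; rw [contract_x t]; simp [hrz]
  -- transfer of the `A`-avoidance to the contraction, given that `z` misses the `x`-cluster with `e` red
  have hav_c : ∀ t : Finset ι, z ∉ K (insert e t) → ∀ b ∈ A, (b ∉ Cz' t ↔ b ∉ Cz t) := by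
    intro t hzt b _
    by_cases hba : b = a
    · subst hba
      exact ⟨fun _ => ((hnotKc t).mp hzt).2, fun _ => haCz' t⟩
    · have h1 : b ∈ Cz (insert e t) ↔ r b ∈ Cz' t := by rw [contract_z t]; rfl
      have hzins : Cz (insert e t) = Cz t := openCluster_z_insert_root ends hea hzt
      rw [hrb b hba, hzins] at h1
      exact not_congr h1.symm
  -- the colour swap inside `E'` exchanges the two pivotal forms
  have hswap : ∑ s ∈ E'.powerset, Rz s = ∑ s ∈ E'.powerset, Rb s := by
    rw [← sum_powerset_sdiff E' Rz]
    refine Finset.sum_congr rfl fun s hs => ?_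
    have hss : E' \ (E' \ s) = s := Finset.sdiff_sdiff_eq_self (Finset.mem_powerset.mp hs)
    have hav_symm : av (E' \ s) ↔ av s := by
      simp only [hav, hss]
      exact ⟨fun h b hb => ⟨(h b hb).2, (h b hb).1⟩, fun h b hb => ⟨(h b hb).2, (h b hb).1⟩⟩
    simp only [hRz, hRb, hss]
    rw [if_congr (and_congr_right fun _ => and_congr_right fun _ => and_congr_right fun _ => hav_symm) rfl rfl]
    split_ifs <;> ring
  -- pointwise inequality
  have hpt : ∀ s ∈ E'.powerset, Ac s + Ad s + (Rb s + Rz s) ≤ T s + T (insert e s) := by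
    intro s hs
    have hsE' : s ⊆ E' := Finset.mem_powerset.mp hs
    have hblue1 : E \ insert e s = E' \ s := sdiff_insert_eq_erase_sdiff E s e
    have hblue2 : E \ s = insert e (E' \ s) := sdiff_eq_insert_erase_sdiff he hsE'
    have hKd := hKmono s
    have hLd := hKmono (E' \ s)
    have hX := dcSquare_cross_nonneg f g hf hg hKd hLd
    have hsq := dcSquare f g (K (insert e s)) (K s) (K (insert e (E' \ s))) (K (E' \ s))
    -- canonical forms of the five summands
    have cAc : Ac s = if z ∉ K (insert e s) ∧ z ∉ K (insert e (E' \ s)) ∧ av s then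
        (f (K (insert e s)) - f (K (insert e (E' \ s)))) * (g (K (insert e s)) - g (K (insert e (E' \ s)))) else 0 := by
      simp only [hAc]
      rw [contract_x s, contract_x (E' \ s)]
      simp only [Set.mem_setOf_eq, hrz]
      refine if_congr ?_ rfl rfl
      refine and_congr_right fun h1 => and_congr_right fun h2 => ?_
      have h1' : z ∉ K (insert e s) := (hzK' s).mp h1
      have h2' : z ∉ K (insert e (E' \ s)) := (hzK' (E' \ s)).mp h2
      constructor
      · intro h3 b hb
        exact ⟨(hav_c s h1' b hb).mp (h3 b hb).1, (hav_c (E' \ s) h2' b hb).mp (h3 b hb).2⟩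
      · intro h3 b hb
        exact ⟨(hav_c s h1' b hb).mpr (h3 b hb).1, (hav_c (E' \ s) h2' b hb).mpr (h3 b hb).2⟩
    have cAd : Ad s = if z ∉ K (insert e s) ∧ z ∉ K (insert e (E' \ s)) ∧ av s then
        (f (K s) - f (K (E' \ s))) * (g (K s) - g (K (E' \ s))) else 0 := by
      simp only [hAd]
      refine if_congr ?_ rfl rfl
      rw [hnotKc s, hnotKc (E' \ s), Finset.forall_mem_insert]
      constructor
      · rintro ⟨h1, h2, ⟨ha1, ha2⟩, h3⟩; exact ⟨⟨h1, ha1⟩, ⟨h2, ha2⟩, h3⟩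
      · rintro ⟨⟨h1, ha1⟩, ⟨h2, ha2⟩, h3⟩; exact ⟨h1, h2, ⟨ha1, ha2⟩, h3⟩
    have cT1 : T (insert e s) = if z ∉ K (insert e s) ∧ z ∉ K (E' \ s) ∧ av s then
        (f (K (insert e s)) - f (K (E' \ s))) * (g (K (insert e s)) - g (K (E' \ s))) else 0 := by
      simp only [hT, hblue1]
      refine if_congr ?_ rfl rfl
      refine and_congr_right fun h1 => and_congr_right fun _ => ?_
      have hz1 : Cz (insert e s) = Cz s := openCluster_z_insert_root ends hea h1
      rw [hz1]
    have cT2 : T s = if z ∉ K s ∧ z ∉ K (insert e (E' \ s)) ∧ av s then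
        (f (K s) - f (K (insert e (E' \ s)))) * (g (K s) - g (K (insert e (E' \ s)))) else 0 := by
      simp only [hT, hblue2]
      refine if_congr ?_ rfl rfl
      refine and_congr_right fun _ => and_congr_right fun h2 => ?_
      have hz2 : Cz (insert e (E' \ s)) = Cz (E' \ s) := openCluster_z_insert_root ends hea h2
      rw [hz2]
    rw [cAc, cAd, cT1, cT2]
    simp only [hRz, hRb]
    by_cases hv : av s
    · by_cases p1 : z ∈ K (insert e s) <;> by_cases q1 : z ∈ K (insert e (E' \ s)) <;>
        by_cases p2 : z ∈ K s <;> by_cases q2 : z ∈ K (E' \ s)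
      all_goals first
        | exact absurd (hKd p2) p1
        | exact absurd (hLd q2) q1
        | (simp [hv, p1, p2, q1, q2]; try linarith)
    · simp [hv]
  -- assemble
  calc (∑ s ∈ E'.powerset, Ac s) + (∑ s ∈ E'.powerset, Ad s) + 2 * (∑ s ∈ E'.powerset, Rz s)
      = (∑ s ∈ E'.powerset, Ac s) + (∑ s ∈ E'.powerset, Ad s) + ((∑ s ∈ E'.powerset, Rb s) + (∑ s ∈ E'.powerset, Rz s)) := by
        rw [two_mul, hswap]
    _ = ∑ s ∈ E'.powerset, (Ac s + Ad s + (Rb s + Rz s)) := by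
        rw [Finset.sum_add_distrib, Finset.sum_add_distrib, Finset.sum_add_distrib]
    _ ≤ ∑ s ∈ E'.powerset, (T s + T (insert e s)) := Finset.sum_le_sum hpt
    _ = ∑ t ∈ E.powerset, T t := by
        rw [Finset.sum_add_distrib, hpow, Finset.sum_powerset_insert heE']

/-- **THEOREM R30a (prim-lf-2 gen 30): CW-PA for all finite multigraphs follows from conjecture RZ.**  Fix terminals `x, z`.  Hypothesis (`hRZ`): for every
end-point map `ends`, edge set `E`, finite vertex set `A` and monotone `f, g`, if `x` has a free root edge (`ends e = {x,a}`, `a ≠ x`, `a ≠ z`, `a ∉ A`) then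
some free root edge has `RZ(E,e;A)[f,g] ≥ 0` (the first-rung kernel restricted to `{e blue, a ∈ C_z(red)}` and to `A` unjoined to `z`).  Conclusion: for
every `ends, E, A` and monotone `f, g`, the `A`-avoiding first-rung form `MA(E;A)[f,g]` is `≥ 0`; with `A = ∅` this is the first rung CW-PA for `(E; x, z)`.
[cite: KozmaNitzan2024, Questions 8–9 (§5.5 p. 36) (context)] -/
theorem firstRung_nonneg_of_rz (x z : V)
    (hRZ : ∀ (ends : ι → Sym2 V) (E : Finset ι) (A : Finset V) (f g : Set V → ℝ), Monotone f → Monotone g →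
      (∃ e ∈ E, ∃ a : V, ends e = s(x, a) ∧ a ≠ x ∧ a ≠ z ∧ a ∉ A) →
      ∃ e ∈ E, ∃ a : V, ends e = s(x, a) ∧ a ≠ x ∧ a ≠ z ∧ a ∉ A ∧
        0 ≤ ∑ s ∈ (E.erase e).powerset,
          (if z ∈ openCluster (ends '' (↑(insert e s) : Set ι)) x ∧ z ∉ openCluster (ends '' (↑s : Set ι)) x ∧
                z ∉ openCluster (ends '' (↑(insert e (E.erase e \ s)) : Set ι)) x ∧
                ∀ b ∈ A, b ∉ openCluster (ends '' (↑s : Set ι)) z ∧ b ∉ openCluster (ends '' (↑(E.erase e \ s) : Set ι)) z then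
            (f (openCluster (ends '' (↑s : Set ι)) x) - f (openCluster (ends '' (↑(insert e (E.erase e \ s)) : Set ι)) x)) *
              (g (openCluster (ends '' (↑s : Set ι)) x) - g (openCluster (ends '' (↑(insert e (E.erase e \ s)) : Set ι)) x))
          else 0))
    (ends : ι → Sym2 V) (E : Finset ι) (A : Finset V) (f g : Set V → ℝ) (hf : Monotone f) (hg : Monotone g) :
    0 ≤ ∑ t ∈ E.powerset,
        (if z ∉ openCluster (ends '' (↑t : Set ι)) x ∧ z ∉ openCluster (ends '' (↑(E \ t) : Set ι)) x ∧
              ∀ b ∈ A, b ∉ openCluster (ends '' (↑t : Set ι)) z ∧ b ∉ openCluster (ends '' (↑(E \ t) : Set ι)) z then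
          (f (openCluster (ends '' (↑t : Set ι)) x) - f (openCluster (ends '' (↑(E \ t) : Set ι)) x)) *
            (g (openCluster (ends '' (↑t : Set ι)) x) - g (openCluster (ends '' (↑(E \ t) : Set ι)) x))
        else 0) := by
  -- strong induction on the number of edges, everything else universally quantified
  suffices H : ∀ (n : ℕ) (ends : ι → Sym2 V) (E : Finset ι), E.card = n → ∀ (A : Finset V) (f g : Set V → ℝ), Monotone f → Monotone g →
      0 ≤ ∑ t ∈ E.powerset,
        (if z ∉ openCluster (ends '' (↑t : Set ι)) x ∧ z ∉ openCluster (ends '' (↑(E \ t) : Set ι)) x ∧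
              ∀ b ∈ A, b ∉ openCluster (ends '' (↑t : Set ι)) z ∧ b ∉ openCluster (ends '' (↑(E \ t) : Set ι)) z then
          (f (openCluster (ends '' (↑t : Set ι)) x) - f (openCluster (ends '' (↑(E \ t) : Set ι)) x)) *
            (g (openCluster (ends '' (↑t : Set ι)) x) - g (openCluster (ends '' (↑(E \ t) : Set ι)) x))
        else 0) from H E.card ends E rfl A f g hf hg
  intro n
  induction n using Nat.strong_induction_on with
  | _ n ih =>
  intro ends E hEn A f g hf hg
  -- case 1: an `x–z` edge — every colouring has a monochromatic `x–z` path
  by_cases hxzE : ∃ e ∈ E, ends e = s(x, z)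
  · obtain ⟨e, he, hez⟩ := hxzE
    refine le_of_eq (Eq.symm (Finset.sum_eq_zero fun t ht => ?_))
    have hor : z ∈ openCluster (ends '' (↑t : Set ι)) x ∨ z ∈ openCluster (ends '' (↑(E \ t) : Set ι)) x := by
      by_cases het : e ∈ t
      · exact Or.inl (mem_openCluster_of_edge ends het hez (mem_openCluster_self _ x))
      · exact Or.inr (mem_openCluster_of_edge ends (Finset.mem_sdiff.mpr ⟨he, het⟩) hez (mem_openCluster_self _ x))
    rw [if_neg]
    rintro ⟨h1, h2, -⟩
    rcases hor with h | h
    · exact h1 h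
    · exact h2 h
  -- case 2: a proper root edge `{x, a}`, `a ≠ x` (and then `a ≠ z` by case 1)
  by_cases hroot : ∃ e ∈ E, ∃ a : V, ends e = s(x, a) ∧ a ≠ x
  · -- choose the root edge: a free one with `RZ ≥ 0` if some free one exists, else any (its far end is avoided and `RZ = 0`)
    have pick : ∃ e ∈ E, ∃ a : V, ends e = s(x, a) ∧ a ≠ x ∧ a ≠ z ∧
        0 ≤ ∑ s ∈ (E.erase e).powerset,
          (if z ∈ openCluster (ends '' (↑(insert e s) : Set ι)) x ∧ z ∉ openCluster (ends '' (↑s : Set ι)) x ∧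
                z ∉ openCluster (ends '' (↑(insert e (E.erase e \ s)) : Set ι)) x ∧
                ∀ b ∈ A, b ∉ openCluster (ends '' (↑s : Set ι)) z ∧ b ∉ openCluster (ends '' (↑(E.erase e \ s) : Set ι)) z then
            (f (openCluster (ends '' (↑s : Set ι)) x) - f (openCluster (ends '' (↑(insert e (E.erase e \ s)) : Set ι)) x)) *
              (g (openCluster (ends '' (↑s : Set ι)) x) - g (openCluster (ends '' (↑(insert e (E.erase e \ s)) : Set ι)) x))
          else 0) := by
      by_cases hfree : ∃ e ∈ E, ∃ a : V, ends e = s(x, a) ∧ a ≠ x ∧ a ≠ z ∧ a ∉ A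
      · obtain ⟨e, he, a, hea, hax, haz, -, hpos⟩ := hRZ ends E A f g hf hg hfree
        exact ⟨e, he, a, hea, hax, haz, hpos⟩
      · obtain ⟨e, he, a, hea, hax⟩ := hroot
        have haz : a ≠ z := fun h => hxzE ⟨e, he, by rw [hea, h]⟩
        have haA : a ∈ A := by
          by_contra h
          exact hfree ⟨e, he, a, hea, hax, haz, h⟩
        refine ⟨e, he, a, hea, hax, haz, le_of_eq (Eq.symm (Finset.sum_eq_zero fun s _ => ?_))⟩
        rw [if_neg]
        rintro ⟨h1, h2, -, h4⟩
        exact (h4 a haA).1 ((mem_insert_root_iff ends hea s z).mp ⟨h1, h2⟩).2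
    obtain ⟨e, he, a, hea, hax, haz, hpos⟩ := pick
    have step := firstRung_avoid_step ends E he hea (Ne.symm hax) (Ne.symm haz) A f g hf hg
    have hcard : (E.erase e).card < n := by
      rw [Finset.card_erase_of_mem he]
      have : 0 < E.card := Finset.card_pos.mpr ⟨e, he⟩
      omega
    -- the pull-backs of `f, g` along the relabelling are monotone
    have hfr : Monotone (fun W : Set V => f {y | (if y = a then x else y) ∈ W}) :=
      fun W W' hWW' => hf (fun y (hy : (if y = a then x else y) ∈ W) => hWW' hy)
    have hgr : Monotone (fun W : Set V => g {y | (if y = a then x else y) ∈ W}) :=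
      fun W W' hWW' => hg (fun y (hy : (if y = a then x else y) ∈ W) => hWW' hy)
    have ih1 := ih _ hcard (fun i => Sym2.map (fun w => if w = a then x else w) (ends i)) (E.erase e) rfl A _ _ hfr hgr
    have ih2 := ih _ hcard ends (E.erase e) rfl (insert a A) f g hf hg
    beta_reduce at ih1
    linarith [step, ih1, ih2, hpos]
  · -- case 3: `x` meets only loops: every cluster of `x` is `{x}`, every summand vanishes
    have hloop : ∀ t : Finset ι, t ⊆ E → ∀ i ∈ t, x ∈ ends i → ends i = s(x, x) := by
      intro t ht i hi hxi
      have hspec := Sym2.other_spec hxi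
      by_contra hne
      apply hroot
      refine ⟨i, ht hi, Sym2.Mem.other hxi, hspec.symm, fun h => hne ?_⟩
      rw [← hspec, h]
    refine le_of_eq (Eq.symm (Finset.sum_eq_zero fun t ht => ?_))
    have htE : t ⊆ E := Finset.mem_powerset.mp ht
    have h1 : openCluster (ends '' (↑t : Set ι)) x = {y | y = x} :=
      Set.ext fun y => mem_openCluster_iff_eq_of_noRoot ends (hloop t htE) y
    have h2 : openCluster (ends '' (↑(E \ t) : Set ι)) x = {y | y = x} :=
      Set.ext fun y => mem_openCluster_iff_eq_of_noRoot ends (hloop (E \ t) Finset.sdiff_subset) y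
    rw [h1, h2]
    simp

end main

end Coefficientwise

end Summit.CriticalPhenomena.PercolationContinuityZ3.Theorems
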